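import Summits.BirchSwinnertonDyer.BirchSwinnertonDyer.Theorems.SylvesterTwoHeegnerIndexUpperOffV0ResInjectiveFields
import Summits.BirchSwinnertonDyer.BirchSwinnertonDyer.Theorems.SylvesterTwoHeegnerIndexUpperOffV0ModTwoImage
import Literature.NumberTheory.EllipticCurves.HeegnerPointsKolyvaginPrimaryPairingProofs
import Literature.NumberTheory.EllipticCurves.KummerSelmerStructure
import Literature.NumberTheory.GaloisRepresentations.GaloisCohomologyInfResProofs
import HarnessLib

/-!
# K7t crux `UpperOffV0HSY` (item 19581): Gross's Prop. 9.1 and McCallum's (2) at `p = 2` in the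
# tree's Kolyvagin-pairing currency `[x, ρ] = h1Eval`

Route `SylvesterTwoHeegnerIndex` (cell bsd-cm, rung K7t).  The tree's Kolyvagin descent evaluates classes
`x ∈ H¹(K, E[n])` on `Γ_{K(E[n])}` by the pairing `h1Eval W n x ρ = [x, ρ]`
(`HeegnerPointsKolyvaginPairing`), and its Step B (`exists_h1Eval_eq_of_indep`,
`IsLiftOfAut.exists_h1Eval_conj_mul_order`, McCallum 1991 §3 (2) / Prop. 3.1) rests on
**Gross's Prop. 9.1** *"if `[s, ρ] = 0` for all `ρ ∈ Gal(ℚ̄/L)` then `s = 0`"*, proved there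
(`eq_zero_of_h1Eval_eq_zero`) from an element acting as `−1` on `E[n]` and `2 ∈ (ℤ/n)ˣ` — both
unavailable at `n = 2^M`.  This file supplies the `p = 2` replacements:

* §1 `eq_zero_of_h1Eval_eq_zero_of_res_injective` (generic bridge, any `W/K`, any `n`): Prop. 9.1 in
  `h1Eval` currency follows from the injectivity of `res : H¹(K, E[n]) → H¹(K(E[n]), E[n])`
  (`res [φ] = [φ ∘ res]`, `KummerSelmerStructure.galoisCohomology.res_one_oneCocycleClass`, and
  `absGaloisRestrict` lands in `Γ_{K(E[n])}`);
* §2 `eq_zero_of_h1Eval_eq_zero_twoPow` — **Prop. 9.1 at `n = 2^M` for every `F`-model of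
  `y² = x³ − c` with `∛c ∉ F`** (from the landed stub `res_injective_divisionField_twoPow_of_mordell`),
  and the `ℚ` / quadratic-field instances for both curves of HSY's pair;
* §3 `exists_h1Eval_eq_of_indep_of_propNineOne` — **McCallum's (2) with Prop. 9.1 as a HYPOTHESIS**
  (generic: `p` prime, `p ∣ n`, `E[p]` simple with scalar commutant): the tree's
  `exists_h1Eval_eq_of_indep` verbatim with `(hz, hu)` replaced by Prop. 9.1 — so that at `p = 2`
  it is fed by §2 and by `two_torsion_subgroup_eq_bot_or_top` / `two_torsion_equivariant_eq_smul`
  (`…UpperOffV0ModTwoImage`); §4 the `2^M` instance `exists_h1Eval_eq_of_indep_twoPow`.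

NOT the crux: inputs of Step B of the off-𝒱₀ 2-adic Kolyvagin line; the sharp bound stays open.
-/

noncomputable section

open scoped Classical
open Field WeierstrassCurve Literature.NumberTheory.EllipticCurves
  Literature.NumberTheory.EllipticCurves.HuShuYin2019 Literature.NumberTheory.GaloisRepresentations

set_option autoImplicit false
set_option linter.dupNamespace false

namespace Summit.BirchSwinnertonDyer.BirchSwinnertonDyer.Theorems.SylvesterTwoUpper

universe u v w

/-! ## §1 Prop. 9.1 in `h1Eval` currency from the injectivity of restriction -/

section Bridge

variable {K : Type u} [Field K] [CharZero K] (W : WeierstrassCurve K) [W.IsElliptic]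

/-- `Γ_{K(E[n])}` as the kernel of restriction to the division field: the tree's
`absGaloisFixingSubgroup (W.divisionField n)` is `torsionFixing W n`. [folklore] -/
theorem absGaloisFixingSubgroup_divisionField_eq (n : ℕ) [NeZero n] :
    absGaloisFixingSubgroup (W.divisionField n) = torsionFixing W (n : ℤ) := by
  ext σ
  rw [mem_absGaloisFixingSubgroup_iff, mem_torsionFixing_iff]
  constructor
  · intro h
    have hσ : σ ∈ ((W.divisionField n).fixingSubgroup : Subgroup (absoluteGaloisGroup K)) :=
      fun y => h y y.2
    rw [W.fixingSubgroup_divisionField n] at hσ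
    exact (W.mem_fixingSubgroupOfModule_geomTorsion_iff n).mp hσ
  · intro h x hx
    exact (W.mem_divisionField_iff n).mp hx σ h

omit [CharZero K] [W.IsElliptic] in
/-- A continuous crossed homomorphism vanishing everywhere has trivial class. [folklore] -/
theorem oneCocycleClass_eq_zero_of_forall_eq_zero {R : Type w} [Ring R] [TopologicalSpace R]
    {G : Type v} [Group G] [TopologicalSpace G] [IsTopologicalGroup G] (X : TopRep.{v} R G)
    {φ : contOneCocycles X} (h : ∀ g, φ.1 g = 0) : oneCocycleClass X φ = 0 := by
  have hφ : φ = 0 := Subtype.ext (ContinuousMap.ext h)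
  rw [hφ, oneCocycleClass_zero]

/-- **Gross's Prop. 9.1 from the injectivity of restriction** (generic bridge): if
`res : H¹(K, E[n]) → H¹(K(E[n]), E[n])` is injective, a class `x` with `[x, ρ] = 0` for all
`ρ ∈ Γ_{K(E[n])}` vanishes (`res [φ] = [φ ∘ res]` and `res(Γ_{K(E[n])}) ⊆ Γ_{K(E[n])}`).
[cite: GrossLMS1991, Prop. 9.1] -/
theorem eq_zero_of_h1Eval_eq_zero_of_res_injective (n : ℕ) [NeZero n]
    (hinj : Function.Injective (galoisCohomology.res (W.torsionGaloisModule (n : ℤ))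
      (W.divisionField n) 1))
    {x : galH1Torsion W (n : ℤ)} (hx : ∀ ρ ∈ torsionFixing W (n : ℤ), h1Eval W (n : ℤ) x ρ = 0) :
    x = 0 := by
  have e : oneCocycleClass (W.torsionGaloisModule (n : ℤ)).toTopRep (reprCocycle W (n : ℤ) x) = x :=
    oneCocycleClass_reprCocycle W (n : ℤ) x
  have h := galoisCohomology.res_one_oneCocycleClass (ρ := W.torsionGaloisModule (n : ℤ))
    (W.divisionField n) (reprCocycle W (n : ℤ) x)
  rw [e] at h
  have key : ∀ g, (contOneCocycles.pullback (absGaloisRestrict K (W.divisionField n))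
      (X := (W.torsionGaloisModule (n : ℤ)).toTopRep)
      (Y := DiscreteGaloisModule.toTopRep
        (GaloisRep.restrictField (W.divisionField n) (W.torsionGaloisModule (n : ℤ))))
      (TopRep.ofHom ⟨ContinuousLinearMap.id ℤ (geomTorsion W (n : ℤ)), fun _ => rfl⟩)
      (reprCocycle W (n : ℤ) x)).1 g = 0 := by
    intro g
    have hg : absGaloisRestrict K (W.divisionField n) g ∈ torsionFixing W (n : ℤ) := by
      rw [← absGaloisFixingSubgroup_divisionField_eq W n]
      exact absGaloisRestrict_mem_absGaloisFixingSubgroup K (W.divisionField n) g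
    have h0 : (reprCocycle W (n : ℤ) x).1 (absGaloisRestrict K (W.divisionField n) g) = 0 :=
      hx _ hg
    rw [contOneCocycles.pullback_apply, h0, map_zero]
  rw [oneCocycleClass_eq_zero_of_forall_eq_zero _ key] at h
  exact hinj (h.trans (map_zero _).symm)

end Bridge

/-! ## §2 Prop. 9.1 at `n = 2^M` for the Mordell curves -/

section TwoPow

variable {F : Type u} [Field F] [NumberField F]

/-- **Gross's Prop. 9.1 at `p = 2`** for every `F`-model `B` of `y² = x³ − c` with `∛c ∉ F` and
every `M ≥ 1`: a class `x ∈ H¹(F, E[2^M])` with `[x, ρ] = 0` for all `ρ ∈ Γ_{F(E[2^M])}` is zero.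
[cite: GrossLMS1991, Prop. 9.1] -/
theorem eq_zero_of_h1Eval_eq_zero_twoPow {c : F} (hc : ∀ x : F, x ^ 3 ≠ c)
    (B : WeierstrassCurve F) [B.IsElliptic] {C : VariableChange F}
    (hCB : C • B = ⟨0, 0, 0, 0, -c⟩) {M : ℕ} (hM : 1 ≤ M)
    {x : galH1Torsion B ((2 ^ M : ℕ) : ℤ)}
    (hx : ∀ ρ ∈ torsionFixing B ((2 ^ M : ℕ) : ℤ), h1Eval B ((2 ^ M : ℕ) : ℤ) x ρ = 0) : x = 0 :=
  haveI : NeZero (2 ^ M : ℕ) := ⟨pow_ne_zero _ two_ne_zero⟩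
  eq_zero_of_h1Eval_eq_zero_of_res_injective B (2 ^ M)
    (res_injective_divisionField_twoPow_of_mordell hc B hCB hM) hx

/-- Prop. 9.1 at `2^M` over `ℚ` for every `ℚ`-model of `E_p` (`p` odd prime).
[cite: GrossLMS1991, Prop. 9.1] -/
theorem eq_zero_of_h1Eval_eq_zero_twoPow_rat {p : ℕ} (hp : p.Prime) (hp2 : p ≠ 2)
    (B : WeierstrassCurve ℚ) [B.IsElliptic]
    (hB : ∃ C : VariableChange ℚ, C • B = cubeSumCurve (p : ℚ)) {M : ℕ} (hM : 1 ≤ M)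
    {x : galH1Torsion B ((2 ^ M : ℕ) : ℤ)}
    (hx : ∀ ρ ∈ torsionFixing B ((2 ^ M : ℕ) : ℤ), h1Eval B ((2 ^ M : ℕ) : ℤ) x ρ = 0) : x = 0 :=
  haveI : NeZero (2 ^ M : ℕ) := ⟨pow_ne_zero _ two_ne_zero⟩
  eq_zero_of_h1Eval_eq_zero_of_res_injective B (2 ^ M)
    (res_injective_divisionField_twoPow_rat hp hp2 B hB hM) hx

/-- Prop. 9.1 at `2^M` over a quadratic number field `K` for every `K`-model of `E_p ×_ℚ K`.
[cite: GrossLMS1991, Prop. 9.1] -/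
theorem eq_zero_of_h1Eval_eq_zero_twoPow_quadratic (K : Type) [Field K] [NumberField K]
    {p : ℕ} (hp : p.Prime) (hp2 : p ≠ 2) (hK : Module.finrank ℚ K = 2)
    (B : WeierstrassCurve K) [B.IsElliptic]
    (hB : ∃ C : VariableChange K, C • B = (cubeSumCurve (p : ℚ)).baseChange K) {M : ℕ} (hM : 1 ≤ M)
    {x : galH1Torsion B ((2 ^ M : ℕ) : ℤ)}
    (hx : ∀ ρ ∈ torsionFixing B ((2 ^ M : ℕ) : ℤ), h1Eval B ((2 ^ M : ℕ) : ℤ) x ρ = 0) : x = 0 :=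
  haveI : NeZero (2 ^ M : ℕ) := ⟨pow_ne_zero _ two_ne_zero⟩
  eq_zero_of_h1Eval_eq_zero_of_res_injective B (2 ^ M)
    (res_injective_divisionField_twoPow_quadratic K hp hp2 hK B hB hM) hx

/-- The same for the partner `E_{3p²}` over a quadratic field. [cite: GrossLMS1991, Prop. 9.1] -/
theorem eq_zero_of_h1Eval_eq_zero_twoPow_quadratic_partner (K : Type) [Field K] [NumberField K]
    {p : ℕ} (hp : p.Prime) (hp2 : p ≠ 2) (hK : Module.finrank ℚ K = 2)
    (A : WeierstrassCurve K) [A.IsElliptic]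
    (hA : ∃ C : VariableChange K, C • A = (cubeSumCurve (3 * (p : ℚ) ^ 2)).baseChange K) {M : ℕ}
    (hM : 1 ≤ M) {x : galH1Torsion A ((2 ^ M : ℕ) : ℤ)}
    (hx : ∀ ρ ∈ torsionFixing A ((2 ^ M : ℕ) : ℤ), h1Eval A ((2 ^ M : ℕ) : ℤ) x ρ = 0) : x = 0 :=
  haveI : NeZero (2 ^ M : ℕ) := ⟨pow_ne_zero _ two_ne_zero⟩
  eq_zero_of_h1Eval_eq_zero_of_res_injective A (2 ^ M)
    (res_injective_divisionField_twoPow_quadratic_partner K hp hp2 hK A hA hM) hx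

end TwoPow

/-! ## §3 McCallum's (2) with Prop. 9.1 as a hypothesis (generic) -/

section McCallumTwo

variable {K : Type u} [Field K] (W : WeierstrassCurve K)

/-- **McCallum 1991, §3 (2), with Gross's Prop. 9.1 as a hypothesis**: for `p` prime, `p ∣ n`,
`E[p]` a simple `Γ_K`-module with scalar commutant, Prop. 9.1 for `H¹(K, E[n])`, and classes
`x_i ∈ H¹(K, E[n])` killed by `p^{eᵢ}` and independent, every `t ∈ ∏ E[n][p^{eᵢ}]` is `([x_i, ρ])_i`
for some `ρ ∈ Γ_{K(E[n])}`.  The tree's `exists_h1Eval_eq_of_indep` verbatim, its use of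
`eq_zero_of_h1Eval_eq_zero` (which needs `−1 ∈ ρ(Γ_K)` and `2 ∈ (ℤ/n)ˣ`) replaced by the
hypothesis `h91` — so that it applies at `p = 2`. [cite: McCallumLMS1991, §3 (2)] -/
theorem exists_h1Eval_eq_of_indep_of_propNineOne {p : ℕ} (hp : p.Prime) {n : ℤ} (hpn : (p : ℤ) ∣ n)
    (hS : ∀ H : AddSubgroup (geomTorsion W p),
      (∀ g : absoluteGaloisGroup K, ∀ t ∈ H, g • t ∈ H) → H = ⊥ ∨ H = ⊤)
    (hC : ∀ f : geomTorsion W p →+ geomTorsion W p,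
      (∀ (g : absoluteGaloisGroup K) (t : geomTorsion W p), f (g • t) = g • f t) →
        ∃ k : ℤ, ∀ t, f t = k • t)
    (h91 : ∀ x : galH1Torsion W n, (∀ ρ ∈ torsionFixing W n, h1Eval W n x ρ = 0) → x = 0)
    {ι : Type*} [Fintype ι] (xs : ι → galH1Torsion W n) (e : ι → ℕ)
    (he : ∀ i, ((p : ℤ) ^ e i) • xs i = 0)
    (hind : ∀ a : ι → ℤ, ∑ i, a i • xs i = 0 → ∀ i, ((p : ℤ) ^ e i) ∣ a i)
    (t : ι → geomTorsion W n) (ht : ∀ i, ((p : ℤ) ^ e i) • t i = 0) :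
    ∃ ρ ∈ torsionFixing W n, ∀ i, h1Eval W n (xs i) ρ = t i := by
  set ι₁ : geomTorsion W p →+ geomTorsion W n :=
    AddSubgroup.inclusion (W.geomTorsion_le_of_dvd hpn) with hι₁
  have hιG : ∀ (g : absoluteGaloisGroup K) (s : geomTorsion W p), ι₁ (g • s) = g • ι₁ s :=
    fun _ _ ↦ rfl
  have hrange : ∀ s : geomTorsion W n, (p : ℤ) • s = 0 → ∃ s₁, ι₁ s₁ = s := fun s hs ↦ by
    refine ⟨⟨(s : geomPoints W), ?_⟩, rfl⟩
    rw [mem_geomTorsion_iff]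
    have := congrArg (fun x : geomTorsion W n ↦ (x : geomPoints W)) hs
    simpa using this
  have hfull := KolyvaginPairing.eq_piTors_of_stable_of_indep hp hS hC ι₁ hιG hrange
    (Finset.univ.sup e) (fun i ↦ Finset.le_sup (Finset.mem_univ i)) (jointRangeN W n xs)
    (fun g m hm ↦ smul_mem_jointRangeN W n xs g hm) (fun m hm i ↦ ?_) (fun a ha ↦ ?_)
  · have : t ∈ jointRangeN W n xs := by rw [hfull]; exact ht
    exact this
  · obtain ⟨ρ, hρ, hm⟩ := hm
    rw [← hm i, ← h1Eval_zsmul W n _ _ hρ, he i, h1Eval_zero W n hρ]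
  · refine hind a (h91 _ fun ρ hρ ↦ ?_)
    rw [h1Eval_sum W n _ _ hρ]
    simp only [h1Eval_zsmul W n _ _ hρ]
    exact ha _ ⟨ρ, hρ, fun i ↦ rfl⟩

end McCallumTwo

/-! ## §4 McCallum's (2) at `p = 2` for the Mordell curves -/

section McCallumTwoPow

variable {F : Type u} [Field F] [NumberField F]

/-- **McCallum's (2) at `p = 2`, level `2^M`, for every `F`-model `B` of `y² = x³ − c` with
`∛c ∉ F` and `ω ∉ F`**: for classes `x_i ∈ H¹(F, E[2^M])` killed by `2^{eᵢ}` and independent,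
every `t ∈ ∏ E[2^M][2^{eᵢ}]` is `([x_i, ρ])_i` for some `ρ ∈ Γ_{F(E[2^M])}` — McCallum's (2) with
its three standing inputs at `2` DISCHARGED (`hS`, `hC`: `…ModTwoImage`; Prop. 9.1: §2).
[cite: McCallumLMS1991, §3 (2)] -/
theorem exists_h1Eval_eq_of_indep_twoPow {c : F} (hc : ∀ x : F, x ^ 3 ≠ c)
    (hωF : ∀ x : F, x ^ 2 + x + 1 ≠ 0) (B : WeierstrassCurve F) [B.IsElliptic]
    {C : VariableChange F} (hCB : C • B = ⟨0, 0, 0, 0, -c⟩) {M : ℕ} (hM : 1 ≤ M)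
    {ι : Type*} [Fintype ι] (xs : ι → galH1Torsion B ((2 ^ M : ℕ) : ℤ)) (e : ι → ℕ)
    (he : ∀ i, ((2 : ℤ) ^ e i) • xs i = 0)
    (hind : ∀ a : ι → ℤ, ∑ i, a i • xs i = 0 → ∀ i, ((2 : ℤ) ^ e i) ∣ a i)
    (t : ι → geomTorsion B ((2 ^ M : ℕ) : ℤ)) (ht : ∀ i, ((2 : ℤ) ^ e i) • t i = 0) :
    ∃ ρ ∈ torsionFixing B ((2 ^ M : ℕ) : ℤ), ∀ i, h1Eval B ((2 ^ M : ℕ) : ℤ) (xs i) ρ = t i := by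
  have hpn : ((2 : ℕ) : ℤ) ∣ ((2 ^ M : ℕ) : ℤ) := by
    obtain ⟨k, hk⟩ : ∃ k, M = k + 1 := ⟨M - 1, by omega⟩
    exact ⟨2 ^ k, by rw [hk]; push_cast; ring⟩
  exact exists_h1Eval_eq_of_indep_of_propNineOne B Nat.prime_two hpn
    (two_torsion_subgroup_eq_bot_or_top hc B hCB)
    (two_torsion_equivariant_eq_smul hc hωF B hCB)
    (fun x hx => eq_zero_of_h1Eval_eq_zero_twoPow hc B hCB hM hx) xs e
    (by exact_mod_cast he) (by exact_mod_cast hind) t (by exact_mod_cast ht)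

end McCallumTwoPow

end Summit.BirchSwinnertonDyer.BirchSwinnertonDyer.Theorems.SylvesterTwoUpper

end
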